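import Summits.QuantumFields.YangMills.Theorems.AlphaInputsT3ACv3EMLTwoFieldIterUniformAllL
import Summits.QuantumFields.YangMills.Theorems.AlphaInputsT3ACv3FLContractionCore
import HarnessLib

/-!
# `AlphaInputsT3ACv3FLContractionCoreAllL` — ★w1 g0's ONE CONTRACTION STEP FOR THE `hLift` BINDER (`FLContraction.norm_defect_after_step_le`, memo v2.1 row R6-core) AT **EVERY**
# BLOCK SIZE `L ≥ 2`: the proviso `d + 2 ≤ L` is removed by feeding the derivative row from `…EMLTwoFieldIterUniformAllL` (Duhamel form, p594803) instead of R3 — so the (FL) Newton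
# route's step is available at `L = 3`, which `HistoryTailL` ∕ `FluctuationComparisonRegPrIntL` ∕ 2′χ need (`∀ odd L > 1`) — cell `ym3-torus`, width seat `ym-ust-19936-w5` (g0); this
# seat's LOCATED NOTE 2026-08-28T01:21Z, third file of the `…AllL` set (p593768, p594803)

WHAT.  Verbatim ★w1's statement and proof (the stencil-gauge step with the lift abstracted as the binder `hT`; the block-constant rotation `φ̂ = φ ∘ iterBlockOf k`; the matrix
inequality `FLContraction.norm_sub_conj_update_le`), with: (i) NO `d + 2 ≤ L`; (ii) the natural scales WITHOUT the group-dimension factor, `m_k(x) = (d+1)·L^k·x`; (iii) the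
derivative-row error `e_k = C₂·m_k(ρ)(m_k(ρ) + m_k(δ))`, `C₂ = (d+1)·18^d(2+(d+1)18^d)·5200ℓ²/(L(L−1))`, under the four smallness rows of `…EMLTwoFieldIterUniformAllL`; (iv) `k ≤ m + K`
(already present).  The conclusion is ★w1's with this `e_k`:
`‖V(c) − \overline{(U′)^{φ̂}}^{(k)}(c)‖ ≤ (τ + e_k) + 2p·ε_V + 2p₂ + (p+p₂)(2(2p + τ + e_k) + (p+p₂)(1 + 2p + τ + e_k))` on `S`.
HONEST FRAMING.  One step, stencil gauge, lift abstracted, exactly as R6-core; (FL)∕`hLift`∕KIN NOT proved; count-neutral helper toward R3 2′∕2′χ (`--supports stmt-QuantumFields-19936`);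
registry untouched; nothing about d = 4, the continuum, or a mass gap; YM₃ on T³ is rung R3, not Clay.

References: T. Bałaban, Commun. Math. Phys. 98 (1985) 17–51 [Balaban1985Averaging] ((11)–(13) p.19, Prop. 4 (134)–(135) p.38, Prop. 5 p.42); CMP 102 (1985) 277–309
[Balaban1985Variational] ((15)–(17) p.280); CMP 109 (1987) 249–301 [Balaban1987RG1] ((0.4), (0.11) p.253).
-/

set_option autoImplicit false

noncomputable section

namespace Summit.QuantumFields.YangMills.Theorems.FLContractionAllL

open Finset
open scoped Matrix.Norms.L2Operator
open Literature.MathematicalPhysics.QuantumFieldTheory.Balaban1983to89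
open T4Continuum AveragingRT BlockAveraging ExpMeanLog BlockAveragingEMLLinearised
open Literature.MathematicalPhysics.QuantumFieldTheory.Balaban1983to89.B5Eq118OneStroke (iterBlockOf)
open Summit.QuantumFields.YangMills.Theorems.FLContraction (iter_gaugeAct_blockConst norm_sub_conj_update_le)
open Summit.QuantumFields.YangMills.Theorems.EMLIterUniformAllL (norm_iter_sub_iter_sub_iterLin_le_uniform_allL)

variable {P : Params} {n : Type*} [Fintype n] [DecidableEq n] [Nonempty n]

/-- ★★ **ONE CONTRACTION STEP (stencil gauge, lift abstracted), AT EVERY BLOCK SIZE `L ≥ 2`** — ★w1's `FLContraction.norm_defect_after_step_le` with the derivative-row error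
`e_k = C₂·m_k(ρ)(m_k(ρ) + m_k(δ))` of `EMLIterUniformAllL.norm_iter_sub_iter_sub_iterLin_le_uniform_allL` (no `d + 2 ≤ L`; scales `m_k(x) = (d+1)L^k x`).  Hypotheses: `Q` the characterised
composites of `linAvg`; `k ≤ m + K`; fine `SU(N)` fields `U` (`δ`-close to `1`) and `U′` (`ρ`-close to `U`) under the four smallness rows; datum `V` with `‖V(c) − 1‖ ≤ ε_V` on `S`; coarse
`ψ` (`‖ψ‖ ≤ p`) and `φ` (`‖φ − (1−ψ)‖, ‖φ* − (1+ψ)‖ ≤ p₂`); abstract exactness `hT` with tolerance `τ` on `S`.  Conclusion on `S`: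
`‖V(c) − \overline{(U′)^{φ̂}}^{(k)}(c)‖ ≤ (τ + e_k) + 2p·ε_V + 2p₂ + (p+p₂)(2(2p + τ + e_k) + (p+p₂)(1 + 2p + τ + e_k))`.
[cite: Balaban1985Averaging, Prop. 4 (134)–(135) p.38, (11)–(13) p.19; Balaban1985Variational, (15)–(17) p.280] -/
theorem norm_defect_after_step_le_allL
    (Q : (i : ℕ) → (PBond P 0 → Matrix n n ℂ) → PBond P i → Matrix n n ℂ)
    (hQ0 : ∀ Y, Q 0 Y = Y) (hQs : ∀ (i : ℕ) (Y : PBond P 0 → Matrix n n ℂ) (c : PBond P (i + 1)), Q (i + 1) Y c = linAvg (Q i Y) c)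
    {k : ℕ} (hk : k ≤ P.m + P.K)
    (U U' : GaugeField P 0 (Matrix.specialUnitaryGroup n ℂ)) {δ ρ : ℝ} (hδ : 0 ≤ δ) (hρ0 : 0 ≤ ρ)
    (hU : ∀ b, ‖((U b : Matrix.specialUnitaryGroup n ℂ) : Matrix n n ℂ) - 1‖ ≤ δ)
    (hρ : ∀ b, ‖((U' b : Matrix.specialUnitaryGroup n ℂ) : Matrix n n ℂ) - ((U b : Matrix.specialUnitaryGroup n ℂ) : Matrix n n ℂ)‖ ≤ ρ)
    (hmδ : (((P.d : ℝ) + 1) * ((18 : ℝ) ^ P.d * (2 + ((P.d : ℝ) + 1) * (18 : ℝ) ^ P.d)) * (324 * (((P.d + 2) * P.L : ℕ) : ℝ) ^ 2) / ((P.L : ℝ) * ((P.L : ℝ) - 1))) * (((P.d : ℝ) + 1) * (P.L : ℝ) ^ k * δ) ≤ 1)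
    (h200 : 200 * (((P.d + 2) * P.L : ℕ) : ℝ) * ((((P.d : ℝ) + 1) * (P.L : ℝ) ^ k * ρ) + (((P.d : ℝ) + 1) * (P.L : ℝ) ^ k * δ)) ≤ 1)
    (hm : (((P.d : ℝ) + 1) * ((18 : ℝ) ^ P.d * (2 + ((P.d : ℝ) + 1) * (18 : ℝ) ^ P.d)) * (5200 * (((P.d + 2) * P.L : ℕ) : ℝ) ^ 2) / ((P.L : ℝ) * ((P.L : ℝ) - 1))) * ((((P.d : ℝ) + 1) * (P.L : ℝ) ^ k * ρ) + (((P.d : ℝ) + 1) * (P.L : ℝ) ^ k * δ)) ≤ 1)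
    (hN : 4 * (((P.d + 2) * P.L : ℕ) : ℝ) * ((((P.d : ℝ) + 1) * (P.L : ℝ) ^ k * ρ) + (((P.d : ℝ) + 1) * (P.L : ℝ) ^ k * δ)) < deltaSU n)
    (V : GaugeField P k (Matrix.specialUnitaryGroup n ℂ)) (S : Set (PBond P k)) {εV : ℝ} (hεV : 0 ≤ εV)
    (hV1 : ∀ c ∈ S, ‖((V c : Matrix.specialUnitaryGroup n ℂ) : Matrix n n ℂ) - 1‖ ≤ εV)
    (ψ : Site P k → Matrix n n ℂ) {p : ℝ} (hp : 0 ≤ p) (hψ : ∀ y, ‖ψ y‖ ≤ p)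
    (φ : GaugeTransf P k (Matrix.specialUnitaryGroup n ℂ)) {p₂ : ℝ} (hp₂ : 0 ≤ p₂)
    (hφ : ∀ y, ‖((φ y : Matrix.specialUnitaryGroup n ℂ) : Matrix n n ℂ) - (1 - ψ y)‖ ≤ p₂)
    (hφs : ∀ y, ‖star ((φ y : Matrix.specialUnitaryGroup n ℂ) : Matrix n n ℂ) - (1 + ψ y)‖ ≤ p₂)
    {τ : ℝ} (hτ : 0 ≤ τ)
    (hT : ∀ c ∈ S, ‖Q k (fun b => ((U' b : Matrix.specialUnitaryGroup n ℂ) : Matrix n n ℂ) - ((U b : Matrix.specialUnitaryGroup n ℂ) : Matrix n n ℂ)) c -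
        ((((V c : Matrix.specialUnitaryGroup n ℂ) : Matrix n n ℂ) -
            ((Averaging.iter (fun i => blockAvg (P := P) (j := i) (expMeanLogSU (n := n))) k U c : Matrix.specialUnitaryGroup n ℂ) : Matrix n n ℂ)) -
          (ψ c.tgt - ψ c.src))‖ ≤ τ) :
    ∀ c ∈ S, ‖((V c : Matrix.specialUnitaryGroup n ℂ) : Matrix n n ℂ) -
        ((Averaging.iter (fun i => blockAvg (P := P) (j := i) (expMeanLogSU (n := n))) k
            (GaugeField.gaugeAct (fun x : Site P 0 => φ (iterBlockOf k x)) U') c : Matrix.specialUnitaryGroup n ℂ) : Matrix n n ℂ)‖ ≤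
      (τ + (((P.d : ℝ) + 1) * ((18 : ℝ) ^ P.d * (2 + ((P.d : ℝ) + 1) * (18 : ℝ) ^ P.d)) * (5200 * (((P.d + 2) * P.L : ℕ) : ℝ) ^ 2) / ((P.L : ℝ) * ((P.L : ℝ) - 1))) * ((((P.d : ℝ) + 1) * (P.L : ℝ) ^ k * ρ) * ((((P.d : ℝ) + 1) * (P.L : ℝ) ^ k * ρ) + (((P.d : ℝ) + 1) * (P.L : ℝ) ^ k * δ)))) +
        2 * p * εV + 2 * p₂ +
        (p + p₂) * (2 * (2 * p + (τ + (((P.d : ℝ) + 1) * ((18 : ℝ) ^ P.d * (2 + ((P.d : ℝ) + 1) * (18 : ℝ) ^ P.d)) * (5200 * (((P.d + 2) * P.L : ℕ) : ℝ) ^ 2) / ((P.L : ℝ) * ((P.L : ℝ) - 1))) * ((((P.d : ℝ) + 1) * (P.L : ℝ) ^ k * ρ) * ((((P.d : ℝ) + 1) * (P.L : ℝ) ^ k * ρ) + (((P.d : ℝ) + 1) * (P.L : ℝ) ^ k * δ))))) +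
          (p + p₂) * (1 + 2 * p + (τ + (((P.d : ℝ) + 1) * ((18 : ℝ) ^ P.d * (2 + ((P.d : ℝ) + 1) * (18 : ℝ) ^ P.d)) * (5200 * (((P.d + 2) * P.L : ℕ) : ℝ) ^ 2) / ((P.L : ℝ) * ((P.L : ℝ) - 1))) * ((((P.d : ℝ) + 1) * (P.L : ℝ) ^ k * ρ) * ((((P.d : ℝ) + 1) * (P.L : ℝ) ^ k * ρ) + (((P.d : ℝ) + 1) * (P.L : ℝ) ^ k * δ)))))) := by
  -- the derivative row at level `k` (every `L ≥ 2`), BEFORE generalising the constant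
  have hderiv0 := fun c => (norm_iter_sub_iter_sub_iterLin_le_uniform_allL Q hQ0 hQs U' U hδ hρ0 hU hρ k hk hmδ h200 hm hN k le_rfl c).2
  -- generalise `e_k` (an opaque real with its defining equation; no definitional unfolding downstream)
  obtain ⟨ek, hek⟩ : ∃ x : ℝ, x = (((P.d : ℝ) + 1) * ((18 : ℝ) ^ P.d * (2 + ((P.d : ℝ) + 1) * (18 : ℝ) ^ P.d)) * (5200 * (((P.d + 2) * P.L : ℕ) : ℝ) ^ 2) / ((P.L : ℝ) * ((P.L : ℝ) - 1))) * ((((P.d : ℝ) + 1) * (P.L : ℝ) ^ k * ρ) * ((((P.d : ℝ) + 1) * (P.L : ℝ) ^ k * ρ) + (((P.d : ℝ) + 1) * (P.L : ℝ) ^ k * δ))) := ⟨_, rfl⟩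
  have hek0 : 0 ≤ ek := by
    rw [hek]
    have hL1 : (1 : ℝ) < P.L := by exact_mod_cast P.hL.2
    have hLL : 0 < (P.L : ℝ) * ((P.L : ℝ) - 1) := mul_pos (by linarith) (by linarith)
    positivity
  simp only [← hek] at hderiv0 ⊢
  intro c hc
  have hderiv := hderiv0 c
  -- names
  set Φ : Matrix n n ℂ := ((Averaging.iter (fun i => blockAvg (P := P) (j := i) (expMeanLogSU (n := n))) k U c : Matrix.specialUnitaryGroup n ℂ) : Matrix n n ℂ) with hΦ
  set Φ' : Matrix n n ℂ := ((Averaging.iter (fun i => blockAvg (P := P) (j := i) (expMeanLogSU (n := n))) k U' c : Matrix.specialUnitaryGroup n ℂ) : Matrix n n ℂ) with hΦ'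
  set Vc : Matrix n n ℂ := ((V c : Matrix.specialUnitaryGroup n ℂ) : Matrix n n ℂ) with hVc
  set QZ : Matrix n n ℂ := Q k (fun b => ((U' b : Matrix.specialUnitaryGroup n ℂ) : Matrix n n ℂ) - ((U b : Matrix.specialUnitaryGroup n ℂ) : Matrix n n ℂ)) c with hQZ
  -- `Φ' = V − (ψ₊ − ψ₋) + R`, `‖R‖ ≤ τ + e_k`
  set R : Matrix n n ℂ := Φ' - (Vc - (ψ c.tgt - ψ c.src)) with hR
  have hRn : ‖R‖ ≤ τ + ek := by
    have e : R = (Φ' - Φ - QZ) + (QZ - ((Vc - Φ) - (ψ c.tgt - ψ c.src))) := by rw [hR]; abel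
    rw [e]
    refine (norm_add_le _ _).trans ?_
    have h1 : ‖Φ' - Φ - QZ‖ ≤ ek := hderiv
    have h2 := hT c hc
    linarith
  have hΦ'eq : Φ' = Vc - (ψ c.tgt - ψ c.src) + R := by rw [hR]; abel
  -- the gauge-rotated average at `c`
  have hgauge : ((Averaging.iter (fun i => blockAvg (P := P) (j := i) (expMeanLogSU (n := n))) k
        (GaugeField.gaugeAct (fun x : Site P 0 => φ (iterBlockOf k x)) U') c : Matrix.specialUnitaryGroup n ℂ) : Matrix n n ℂ) =
      ((φ c.src : Matrix.specialUnitaryGroup n ℂ) : Matrix n n ℂ) * Φ' * star ((φ c.tgt : Matrix.specialUnitaryGroup n ℂ) : Matrix n n ℂ) := by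
    rw [iter_gaugeAct_blockConst _ hk φ U']
    show (((φ c.src * Averaging.iter (fun i => blockAvg (P := P) (j := i) (expMeanLogSU (n := n))) k U' c * (φ c.tgt)⁻¹ :
        Matrix.specialUnitaryGroup n ℂ)) : Matrix n n ℂ) = _
    rw [Submonoid.coe_mul, Submonoid.coe_mul]
    rfl
  rw [hgauge, hΦ'eq]
  -- the matrix inequality
  have hVn : ‖Vc‖ ≤ 1 := (CStarRing.norm_of_mem_unitary (Matrix.mem_specialUnitaryGroup_iff.1 (V c).2).1).le
  exact norm_sub_conj_update_le Vc _ _ (ψ c.src) (ψ c.tgt) R hεV hp hp₂ (add_nonneg hτ hek0) hVn (hV1 c hc) (hψ _) (hψ _) (hφ _) (hφs _) hRn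

end Summit.QuantumFields.YangMills.Theorems.FLContractionAllL

end
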